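import Summits.NavierStokesRegularity.NavierStokesRegularity.Theorems.ArgmaxDoorsDefs
import Mathlib.Analysis.SpecialFunctions.Pow.Real
import Mathlib.Topology.Order.Monotone
import HarnessLib

/-!
# ArgmaxDoorsPhaseLemma — door family S35 «ArgmaxDoors», plate Φ «PhaseLemma», PROVED

S-door lane helper (ns-sfl-p1 g5; texts of record nsreg-p1 g29 ROUND-33 `r33/Sketch35.lean` v3 sha16 93168f45ce53c5c4
= tree P0 `Theorems/ArgmaxDoorsDefs.lean` p645080, plate Φ; `--supports stmt-NavierStokesRegularity-0056 --as helper`).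
`phaseLemma_holds : PhaseLemma` BY NAME against P0.
Pure real analysis, no PDE: for a continuous nonnegative `m` on `[t₀,T)` obeying the SUBCRITICAL GROWTH LAW
`m(t₂) ≤ m(t₁)·((T−t₁)/(T−t₂))^a` (`a < 1`) on every slab `[t₁,t₂] ⊂ [t₀,T)` throughout whose half-open part
the phase `g(s) = (T−s)m(s)` exceeds `ε`, the phase is eventually `≤ ε`.

* `PhaseLemma.no_upcross` — once `g(τ) ≤ ε`, `g ≤ ε` on `[τ,T)`: otherwise take the LAST time `σ ≤ t` with
  `g(σ) ≤ ε` (a closed set, `IsClosed.csSup_mem`); on `(σ,t]` the phase exceeds `ε`, so the law gives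
  `g(t) ≤ g(σ)·((T−σ)/(T−t))^{a−1} ≤ g(σ) ≤ ε`.
* `PhaseLemma.phaseLemma` — the plate text verbatim: if `g > ε` throughout `[t₀,T)` the law from `t₀` to
  `t₂ = T − (T−t₀)/K`, `K = (g(t₀)/ε)^{1/(1−a)}`, gives `g(t₂) ≤ g(t₀)K^{a−1} = ε`, absurd; so some `g(τ) ≤ ε`
  and `no_upcross` finishes;
* `phaseLemma_holds : PhaseLemma` — the plate BY NAME.

WHAT THIS IS NOT: a real-variable lemma serving three regularity CRITERIA (doors S35-A/B/C) about hypothetical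
blow-up; item 0056 `NoTypeII` and NS regularity are NOT proved; nothing here is a route or a summit statement.
-/

noncomputable section

open Set

-- the summit's problem namespace repeats the summit name (tree layout)
set_option linter.dupNamespace false

namespace Summit.NavierStokesRegularity.NavierStokesRegularity.Theorems.ArgmaxDoors

namespace PhaseLemma

/-- Slab algebra of the phase: `(T − t)·(m₁·((T−σ)/(T−t))^a) = ((T−σ)·m₁)·((T−σ)/(T−t))^{a−1}` for `σ ≤ t < T`. -/
theorem phase_slab_eq {T σ t : ℝ} (hσt : σ ≤ t) (htT : t < T) (a m₁ : ℝ) :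
    (T - t) * (m₁ * ((T - σ) / (T - t)) ^ a) =
      ((T - σ) * m₁) * ((T - σ) / (T - t)) ^ (a - 1) := by
  have hTt : 0 < T - t := sub_pos.2 htT
  have hTσ : 0 < T - σ := by linarith
  have hX : ((T - σ) / (T - t)) ≠ 0 := (div_pos hTσ hTt).ne'
  rw [Real.rpow_sub_one hX]
  field_simp

/-- The growth factor of the phase is at most one: `((T−σ)/(T−t))^{a−1} ≤ 1` for `σ ≤ t < T`, `a < 1`. -/
theorem phase_factor_le_one {T σ t a : ℝ} (hσt : σ ≤ t) (htT : t < T) (ha : a < 1) :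
    ((T - σ) / (T - t)) ^ (a - 1) ≤ 1 := by
  have hTt : 0 < T - t := sub_pos.2 htT
  refine Real.rpow_le_one_of_one_le_of_nonpos ?_ (by linarith)
  rw [le_div_iff₀ hTt]
  linarith

/-- NO UP-CROSSING. Under the subcritical growth law (`a < 1`) for a continuous nonnegative `m` on `[t₀,T)`,
if the phase `(T−τ)m(τ) ≤ ε` at some `τ ∈ [t₀,T)` then `(T−t)m(t) ≤ ε` for every `t ∈ [τ,T)`. -/
theorem no_upcross {T t₀ a ε : ℝ} {m : ℝ → ℝ} (ha : a < 1)
    (hm : ContinuousOn m (Ico t₀ T)) (hm0 : ∀ t ∈ Ico t₀ T, 0 ≤ m t)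
    (hlaw : ∀ t₁ t₂ : ℝ, t₀ ≤ t₁ → t₁ ≤ t₂ → t₂ < T → (∀ s ∈ Ioc t₁ t₂, ε < (T - s) * m s) →
      m t₂ ≤ m t₁ * ((T - t₁) / (T - t₂)) ^ a)
    {τ : ℝ} (hτ : τ ∈ Ico t₀ T) (hgτ : (T - τ) * m τ ≤ ε) :
    ∀ t ∈ Ico τ T, (T - t) * m t ≤ ε := by
  intro t ht
  by_contra hgt
  push Not at hgt
  -- the set of times in `[τ, t]` where the phase is `≤ ε`
  set S : Set ℝ := Icc τ t ∩ (fun s => (T - s) * m s) ⁻¹' Iic ε with hS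
  have hsub : Icc τ t ⊆ Ico t₀ T := fun s hs => ⟨hτ.1.trans hs.1, hs.2.trans_lt ht.2⟩
  have hg : ContinuousOn (fun s => (T - s) * m s) (Icc τ t) :=
    ((continuousOn_const.sub continuousOn_id).mul (hm.mono hsub))
  have hSclosed : IsClosed S := hg.preimage_isClosed_of_isClosed isClosed_Icc isClosed_Iic
  have hτS : τ ∈ S := ⟨⟨le_rfl, ht.1⟩, hgτ⟩
  have hSne : S.Nonempty := ⟨τ, hτS⟩
  have hSbdd : BddAbove S := ⟨t, fun s hs => hs.1.2⟩
  set σ := sSup S with hσ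
  have hσS : σ ∈ S := hSclosed.csSup_mem hSne hSbdd
  have hτσ : τ ≤ σ := hσS.1.1
  have hσt : σ ≤ t := hσS.1.2
  have hgσ : (T - σ) * m σ ≤ ε := hσS.2
  have hσt' : σ < t := by
    rcases hσt.eq_or_lt with h | h
    · exact absurd (h ▸ hgσ) (not_le.2 hgt)
    · exact h
  -- on `(σ, t]` the phase exceeds `ε`
  have hphase : ∀ s ∈ Ioc σ t, ε < (T - s) * m s := by
    intro s hs
    by_contra hle
    push Not at hle
    have hsS : s ∈ S := ⟨⟨hτσ.trans hs.1.le, hs.2⟩, hle⟩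
    exact (not_lt.2 (le_csSup hSbdd hsS)) hs.1
  have hlaw' := hlaw σ t (hτ.1.trans hτσ) hσt ht.2 hphase
  have hTt : 0 < T - t := sub_pos.2 ht.2
  have h1 : (T - t) * m t ≤ (T - t) * (m σ * ((T - σ) / (T - t)) ^ a) :=
    mul_le_mul_of_nonneg_left hlaw' hTt.le
  rw [phase_slab_eq hσt ht.2] at h1
  have hgσ0 : 0 ≤ (T - σ) * m σ :=
    mul_nonneg (by linarith [ht.2]) (hm0 σ ⟨hτ.1.trans hτσ, hσt.trans_lt ht.2⟩)
  have h2 : ((T - σ) * m σ) * ((T - σ) / (T - t)) ^ (a - 1) ≤ (T - σ) * m σ :=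
    mul_le_of_le_one_right hgσ0 (phase_factor_le_one hσt ht.2 ha)
  linarith

/-- plate Φ «PhaseLemma» (nsreg-p1 ROUND-33, `Sketch35.lean` §4), PROVED — the text verbatim: `t₀ < T`, `a < 1`,
`ε > 0`, `m ≥ 0` continuous on `[t₀,T)` with the subcritical growth law `m(t₂) ≤ m(t₁)·((T−t₁)/(T−t₂))^a` on
every slab `[t₁,t₂] ⊂ [t₀,T)` throughout whose half-open part `(t₁,t₂]` the phase `(T−s)m(s)` exceeds `ε`;
then the phase is `≤ ε` on some end-slab `[t₁,T)`. -/
theorem phaseLemma : ∀ (T t₀ a ε : ℝ) (m : ℝ → ℝ), t₀ < T → a < 1 → 0 < ε →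
    ContinuousOn m (Ico t₀ T) → (∀ t ∈ Ico t₀ T, 0 ≤ m t) →
    (∀ t₁ t₂ : ℝ, t₀ ≤ t₁ → t₁ ≤ t₂ → t₂ < T → (∀ s ∈ Ioc t₁ t₂, ε < (T - s) * m s) →
      m t₂ ≤ m t₁ * ((T - t₁) / (T - t₂)) ^ a) →
    ∃ t₁ ∈ Ico t₀ T, ∀ t ∈ Ico t₁ T, (T - t) * m t ≤ ε := by
  intro T t₀ a ε m ht₀T ha hε hm hm0 hlaw
  by_cases h : ∃ τ ∈ Ico t₀ T, (T - τ) * m τ ≤ ε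
  · obtain ⟨τ, hτ, hgτ⟩ := h
    exact ⟨τ, hτ, no_upcross ha hm hm0 hlaw hτ hgτ⟩
  · exfalso
    push Not at h
    -- the phase exceeds `ε` throughout `[t₀, T)`: run the law from `t₀` to a time close to `T`
    have ht₀ : t₀ ∈ Ico t₀ T := ⟨le_rfl, ht₀T⟩
    set g₀ : ℝ := (T - t₀) * m t₀ with hg₀
    have hg₀ε : ε < g₀ := h t₀ ht₀
    have hg₀pos : 0 < g₀ := hε.trans hg₀ε
    have hTt₀ : 0 < T - t₀ := sub_pos.2 ht₀T
    have h1a : 0 < 1 - a := by linarith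
    set K : ℝ := (g₀ / ε) ^ (1 / (1 - a)) with hK
    have hratio : 1 ≤ g₀ / ε := by rw [le_div_iff₀ hε]; linarith
    have hK1 : 1 ≤ K := Real.one_le_rpow hratio (by positivity)
    have hKpos : 0 < K := one_pos.trans_le hK1
    set t₂ : ℝ := T - (T - t₀) / K with ht₂
    have hTt₂ : T - t₂ = (T - t₀) / K := by rw [ht₂]; ring
    have ht₂T : t₂ < T := by
      have : 0 < (T - t₀) / K := div_pos hTt₀ hKpos
      linarith
    have ht₀₂ : t₀ ≤ t₂ := by
      have : (T - t₀) / K ≤ T - t₀ := div_le_self hTt₀.le hK1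
      linarith
    have hlaw' := hlaw t₀ t₂ le_rfl ht₀₂ ht₂T (fun s hs => h s ⟨hs.1.le, hs.2.trans_lt ht₂T⟩)
    have hX : (T - t₀) / (T - t₂) = K := by
      rw [hTt₂]; field_simp
    have hTt₂pos : 0 < T - t₂ := sub_pos.2 ht₂T
    have h2 : (T - t₂) * m t₂ ≤ (T - t₂) * (m t₀ * ((T - t₀) / (T - t₂)) ^ a) :=
      mul_le_mul_of_nonneg_left hlaw' hTt₂pos.le
    rw [phase_slab_eq ht₀₂ ht₂T, hX] at h2
    -- `g₀ · K^{a-1} = ε`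
    have hKa : K ^ (a - 1) = ε / g₀ := by
      rw [hK, ← Real.rpow_mul (by positivity : (0 : ℝ) ≤ g₀ / ε)]
      have : 1 / (1 - a) * (a - 1) = -1 := by field_simp; ring
      rw [this, Real.rpow_neg_one, inv_div]
    have h3 : g₀ * K ^ (a - 1) = ε := by
      rw [hKa]; field_simp
    have h4 : (T - t₂) * m t₂ ≤ ε := by rw [← h3]; exact h2
    exact (not_lt.2 h4) (h t₂ ⟨ht₀₂, ht₂T⟩)

end PhaseLemma

/-- plate Φ «PhaseLemma» of door family S35 «ArgmaxDoors» BY NAME (P0 `ArgmaxDoorsDefs`, nsreg-p1 ROUND-33):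
the phase `(T−t)‖ω(t)‖_∞` cannot up-cross `ε` under the subcritical growth law and is eventually `≤ ε`. -/
theorem phaseLemma_holds : PhaseLemma :=
  PhaseLemma.phaseLemma

/-- The phase lemma in filter form: under the hypotheses of `PhaseLemma` (continuous `m ≥ 0` on `[t₀,T)` with the
subcritical growth law above the level `ε`), the phase is eventually small as `t ↑ T`:
`(T − t)·m(t) ≤ ε` for all `t < T` close to `T`. -/
theorem PhaseLemma.eventually_le {T t₀ a ε : ℝ} {m : ℝ → ℝ} (hT : t₀ < T) (ha : a < 1) (hε : 0 < ε)
    (hm : ContinuousOn m (Ico t₀ T)) (hm0 : ∀ t ∈ Ico t₀ T, 0 ≤ m t)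
    (hlaw : ∀ t₁ t₂ : ℝ, t₀ ≤ t₁ → t₁ ≤ t₂ → t₂ < T → (∀ s ∈ Ioc t₁ t₂, ε < (T - s) * m s) →
      m t₂ ≤ m t₁ * ((T - t₁) / (T - t₂)) ^ a) :
    ∀ᶠ t in nhdsWithin T (Iio T), (T - t) * m t ≤ ε := by
  obtain ⟨t₁, ht₁, h⟩ := PhaseLemma.phaseLemma T t₀ a ε m hT ha hε hm hm0 hlaw
  exact Filter.mem_of_superset (Ico_mem_nhdsLT ht₁.2) fun t ht => h t ht

end Summit.NavierStokesRegularity.NavierStokesRegularity.Theorems.ArgmaxDoors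

end
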